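import Summits.KontsevichZagierPeriods.KontsevichZagierPeriods.Theses.IsogenyCertificates
import Literature.NumberTheory.Transcendental.KZKernelConjectureForms
import Literature.NumberTheory.Transcendental.KZLogCalculusProofs
import Literature.NumberTheory.Transcendental.SemialgebraicAlgebraicPoints
import Literature.NumberTheory.Transcendental.ManyCurveThetaClassification
import Summits.KontsevichZagierPeriods.KontsevichZagierPeriods.Theorems.EffectiveXMapChains.Negative.PeriodRep

/-!
# Disproof of `AlgebraicModuliRealPeriodCell` (stmt-KontsevichZagierPeriods-18265) — findings

Crux (route `IsogenyCertificates`, rank 6):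
`∀ c ∈ closure {[{x³+αx+β>0}, a/√(x³+αx+β)] | α β a ∈ ℚ̄ ∩ ℝ, 4α³+27β² ≠ 0}, eval c = 0 → c ∈ KZ.relations`.

**Verdict of this cycle: NO KILL, and no kill is possible short of refuting the summit.**

* §1 SANDWICH. `cell_of_summit : KontsevichZagierPeriods → AlgebraicModuliRealPeriodCell` (three lines over
  the tree's `kzKernelConjecture_iff_isRational`): the crux is the kernel form of Conjecture 1 restricted to a
  sub-closure, hence `not_summit_of_not_cell`: any `¬ crux` is a `¬ KontsevichZagierPeriods`. The only
  invariant of `KZ.relations` available in the tree is `KZ.eval` (soundness); a non-membership proof for a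
  value-`0` combination would need a new invariant of all four move sets, i.e. a disproof of the period
  conjecture as formalised.
* §2 LOAD-BEARING ANALYSIS OF THE FOUR SIDE CONDITIONS (`IsAlgebraic ℚ α/β/a`, `4α³+27β² ≠ 0`): NONE is
  load-bearing for TRUTH — the crux with all four dropped (`CellWithoutSideConditions`) is still a special
  case of the summit (`cellWithoutSideConditions_of_summit`), so no `_false_without_<H>` theorem can exist
  unless the summit is false (`not_summit_of_not_cellWithout…`). Sharper: the three algebraicity hypotheses
  are DECORATION — they are implied by the existence of the representation `r` when `a ≠ 0`
  (`isAlgebraic_of_rep`: a `ℚ`-semialgebraic function taking the values `a/√P(n)` at four consecutive large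
  integers pins `1/a², α/a², β/a²` by finite differences), and `a = 0` generators are zero-integrand
  representations, i.e. relations; hence `cell_iff_cellWithoutAlgebraicity : crux ↔ CellWithoutAlgebraicity`
  (LANDED as a Negative lemma, see HANDOFF in the seat's NOTES). The nonsingularity hypothesis is not
  redundant but harmless: dropping it ADDS the nodal cubics `(x−t)²(x+2t)`, `t < 0` algebraic, whose
  generators exist (domain `(2|t|, ∞)`, value `a·π/√(3|t|)`) and the cusp / enclosed-node cases, where no
  `IntegralRep` exists (`1/√P` not integrable at the double root) — `CellWithoutNonsingularity` =
  crux ∧ (an elementary `ℚ̄π`-sector) ∧ (no cross relations, `Ω/π ∉ ℚ̄`: Huber–Wüstholz), still inside S.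
* §3 THE VALUE HYPOTHESIS `eval c = 0` IS LOAD-BEARING (`cell_false_without_valueHypothesis`): the generator
  `[{x³+1>0}, 1/√(x³+1)]` has value `Ω(E₀,₁) > 0` (tree: `periodRep_value`, `realPeriod_pos`), so the closure
  is not inside `relations ≤ ker eval`. (Non-vacuity of the generating set comes with it.)
* §4 MINIMAL SHAPE OF A COUNTEREXAMPLE. `value_eq`: every generator has value `a · Ω(E_{α,β})`,
  `Ω = WeierstrassCurve.realPeriod ⟨0,0,0,α,β⟩ > 0`; `single_generator_kernel`: a single generator with value
  `0` has `a = 0` and IS a relation; `same_cubic_kernel₂`: `[P, a/√P] − [P, b/√P]` with value `0` is a relation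
  (rule 1b). So a counterexample involves ≥ 2 distinct cubics, i.e. a genuine `ℚ̄`-linear relation
  `Σ aᵢ Ω(Eᵢ) = 0`; by `HuberWustholzManyCurvePeriods_holds` (tree THEOREM) such relations live inside
  `ℂ`-isogeny classes, and by §5 every pairwise proportionality inside a class is carried by a REAL isogeny.
* §5 METHOD-LEVEL (kill criterion (2) of the route: "a relation certified only by a NON-REAL isogeny").
  Lattice facts: `no_real_mul_I_of_not_hasCM` — a real lattice admits a real isogeny onto its `(−1)`-twist
  (`Λ → iΛ`) ONLY IF it has CM (converse of the ideator's `cm_imaginary_multiplier`); with the ideator's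
  `conjSymm_multiplier` (φ ↦ φ+φ̄, φ−φ̄) this gives the exact dichotomy `stub_algNormalForm` must implement:
  non-CM twists `E`, `E^tw` are NOT really-isogenous and their real periods `ω₁`, `ω₂/i` are `ℚ̄`-independent
  (HW non-CM block), CM twists are joined by `√−D ∈ End` (irrational real multiplier, the calibration).
  WARNING for the lead (recorded, not a refutation): a normal form "pairwise non-ℂ-isogenous curves" is FALSE
  as a reduction target — `[E] − [E^tw]`, `E` non-CM, is congruent modulo relations to no combination over
  pairwise non-ℂ-isogenous curves (E ≅_ℂ E^tw but `Ω(E), Ω(E^tw)` independent); the correct normal form is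
  "pairwise not joined by a REAL datum", as in the ℚ-line's `realPeriodIndependence` (datum form).
  NUMERICS (kit job j022876, 120 digits, peak-aware quadrature + PSLQ tol 1e-80; j022768/j022854/j022862
  were the debugging runs): calibration `Ω(x³+1)/Ω(x³−1) − √3 = 0.0` (120 d); class-number-2 CM conjugate
  pairs `E± : j = (a ± b√d)/den` for `D = −15, −20, −24, −35, −40` (models `A = 3j(1728−j)`,
  `B = 2j(1728−j)²`, common scaling): ALL of `(Ω(E₊)/Ω(E₋))²`, `(Ω(E₊)/Ω(E₋^tw))²` lie in `ℚ(√d)`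
  (e.g. `D=−15`: `(123−55√5)/10 = ((25−11√5)/10)²` and `(123−55√5)/6`; `D=−35`:
  `(32386303−14483595√5)/8246`), and the twist ratios `(Ω(E)/Ω(E^tw))²` are RATIONAL
  (`1/15, 5/3 | 5, 1/5 | 6, 3/2 | 1/35, 7/5 | 10, 5/2`), as are those of the class-number-1 CM curves
  `j = 8000, −3375, 54000, −32768, 287496, −884736, 16581375` (`2, 1/7, 3, 1/11, 4, 1/19, 7` = `|D|`·□):
  every relation found is the shadow of a REAL isogeny with real-algebraic multiplier (both eigenlines of
  complex conjugation on `Hom` are non-zero in a CM class), exactly as the method needs. Non-CM controls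
  `(A,B) = (−1,1), (−2,1), (1,1), (−7,3), (−3,1)`: `Ω(E)/Ω(E^tw)` has NO relation with `1,√2,√3,√5,√7`
  (height ≤ 1e12) and is a root of no integer polynomial of degree ≤ 8, height ≤ 1e6 — consistent with
  `nonCM_omega_independent`. Kill criterion (2) does not bite on any tested instance.
* NOT ATTEMPTED (positive, prover's work): the calibration membership `[x³+1] − √3·[x³−1] ∈ relations`
  (three-sheet transfer along `(X³+4, 3X², √3)`), i.e. `stub_algXMapTransfer`.
-/

noncomputable section

set_option linter.dupNamespace false

namespace Summit.KontsevichZagierPeriods.KontsevichZagierPeriods.Cruxes.AlgebraicModuliRealPeriodCell.Disproof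

open Set MeasureTheory Polynomial
open Literature.NumberTheory.Transcendental
open Summit.KontsevichZagierPeriods.KontsevichZagierPeriods.Theses.IsogenyCertificates
open Summit.KontsevichZagierPeriods.IsogenyCertificates.EffectiveXMapChainsNegative
  (periodRep periodRep_value realPeriod_pos sqrt_four_mul)

/-! ## §1 The sandwich: crux ⇐ summit (so `¬ crux` refutes the summit) -/

/-- The generating set of the cell, verbatim from the route decl. [folklore] -/
def gens : Set KZ.FormalRep :=
  {d | ∃ (α β a : ℝ) (r : KZ.IntegralRep 1), IsAlgebraic ℚ α ∧ IsAlgebraic ℚ β ∧ IsAlgebraic ℚ a ∧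
    4 * α ^ 3 + 27 * β ^ 2 ≠ 0 ∧ r.domain = {x | 0 < x 0 ^ 3 + α * x 0 + β} ∧
    EqOn r.integrand (fun x => a / Real.sqrt (x 0 ^ 3 + α * x 0 + β)) r.domain ∧ d = KZ.of r}

/-- The crux, unfolded over `gens` (definitional). [folklore] -/
theorem cell_iff :
    AlgebraicModuliRealPeriodCell ↔ ∀ c ∈ AddSubgroup.closure gens, KZ.eval c = 0 → c ∈ KZ.relations :=
  Iff.rfl

/-- The kernel conjecture gives the cell (restriction to a sub-closure). [folklore] -/
theorem cell_of_kzKernelConjecture (h : KZKernelConjecture) : AlgebraicModuliRealPeriodCell :=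
  fun c _ hc => h c hc

/-- **Sandwich, upper half**: the summit implies the crux (via the tree's
`kzKernelConjecture_iff_isRational`). [folklore] -/
theorem cell_of_summit (h : KontsevichZagierPeriods) : AlgebraicModuliRealPeriodCell :=
  cell_of_kzKernelConjecture (kzKernelConjecture_iff_isRational.mpr h)

/-- **Why the crux resists refutation**: any disproof of it is a disproof of the summit. [folklore] -/
theorem not_summit_of_not_cell (h : ¬ AlgebraicModuliRealPeriodCell) : ¬ KontsevichZagierPeriods :=
  fun hS => h (cell_of_summit hS)

/-! ## §2 Load-bearing analysis of the four side conditions: none is load-bearing for truth -/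

/-- Generators with ALL four side conditions dropped (any real `α β a`, singular cubics allowed;
the `IntegralRep` structure still forces `ℚ`-semialgebraic data and absolute convergence). [folklore] -/
def gens₀ : Set KZ.FormalRep :=
  {d | ∃ (α β a : ℝ) (r : KZ.IntegralRep 1), r.domain = {x | 0 < x 0 ^ 3 + α * x 0 + β} ∧
    EqOn r.integrand (fun x => a / Real.sqrt (x 0 ^ 3 + α * x 0 + β)) r.domain ∧ d = KZ.of r}

/-- Generators with the three algebraicity hypotheses dropped. [folklore] -/
def gensNoAlg : Set KZ.FormalRep :=
  {d | ∃ (α β a : ℝ) (r : KZ.IntegralRep 1), 4 * α ^ 3 + 27 * β ^ 2 ≠ 0 ∧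
    r.domain = {x | 0 < x 0 ^ 3 + α * x 0 + β} ∧
    EqOn r.integrand (fun x => a / Real.sqrt (x 0 ^ 3 + α * x 0 + β)) r.domain ∧ d = KZ.of r}

/-- Generators with the nonsingularity hypothesis dropped. [folklore] -/
def gensNoDisc : Set KZ.FormalRep :=
  {d | ∃ (α β a : ℝ) (r : KZ.IntegralRep 1), IsAlgebraic ℚ α ∧ IsAlgebraic ℚ β ∧ IsAlgebraic ℚ a ∧
    r.domain = {x | 0 < x 0 ^ 3 + α * x 0 + β} ∧
    EqOn r.integrand (fun x => a / Real.sqrt (x 0 ^ 3 + α * x 0 + β)) r.domain ∧ d = KZ.of r}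

/-- `AlgebraicModuliRealPeriodCell` without any side condition. [folklore] -/
def CellWithoutSideConditions : Prop :=
  ∀ c ∈ AddSubgroup.closure gens₀, KZ.eval c = 0 → c ∈ KZ.relations

/-- `AlgebraicModuliRealPeriodCell` without `IsAlgebraic ℚ α ∧ IsAlgebraic ℚ β ∧ IsAlgebraic ℚ a`. [folklore] -/
def CellWithoutAlgebraicity : Prop :=
  ∀ c ∈ AddSubgroup.closure gensNoAlg, KZ.eval c = 0 → c ∈ KZ.relations

/-- `AlgebraicModuliRealPeriodCell` without `4α³ + 27β² ≠ 0`. [folklore] -/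
def CellWithoutNonsingularity : Prop :=
  ∀ c ∈ AddSubgroup.closure gensNoDisc, KZ.eval c = 0 → c ∈ KZ.relations

theorem gens_subset_gensNoAlg : gens ⊆ gensNoAlg := by
  rintro d ⟨α, β, a, r, -, -, -, hΔ, hd, hi, rfl⟩
  exact ⟨α, β, a, r, hΔ, hd, hi, rfl⟩

theorem gens_subset_gensNoDisc : gens ⊆ gensNoDisc := by
  rintro d ⟨α, β, a, r, hα, hβ, ha, -, hd, hi, rfl⟩
  exact ⟨α, β, a, r, hα, hβ, ha, hd, hi, rfl⟩

theorem gensNoAlg_subset_gens₀ : gensNoAlg ⊆ gens₀ := by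
  rintro d ⟨α, β, a, r, -, hd, hi, rfl⟩
  exact ⟨α, β, a, r, hd, hi, rfl⟩

theorem gensNoDisc_subset_gens₀ : gensNoDisc ⊆ gens₀ := by
  rintro d ⟨α, β, a, r, -, -, -, hd, hi, rfl⟩
  exact ⟨α, β, a, r, hd, hi, rfl⟩

/-- Even with every side condition dropped the statement is a special case of the summit. [folklore] -/
theorem cellWithoutSideConditions_of_summit (h : KontsevichZagierPeriods) : CellWithoutSideConditions :=
  fun c _ hc => (kzKernelConjecture_iff_isRational.mpr h) c hc

theorem cellWithoutAlgebraicity_of_cellWithoutSideConditions (h : CellWithoutSideConditions) :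
    CellWithoutAlgebraicity :=
  fun c hc hc0 => h c (AddSubgroup.closure_mono gensNoAlg_subset_gens₀ hc) hc0

theorem cellWithoutNonsingularity_of_cellWithoutSideConditions (h : CellWithoutSideConditions) :
    CellWithoutNonsingularity :=
  fun c hc hc0 => h c (AddSubgroup.closure_mono gensNoDisc_subset_gens₀ hc) hc0

theorem cell_of_cellWithoutAlgebraicity (h : CellWithoutAlgebraicity) : AlgebraicModuliRealPeriodCell :=
  fun c hc hc0 => h c (AddSubgroup.closure_mono gens_subset_gensNoAlg hc) hc0

theorem cell_of_cellWithoutNonsingularity (h : CellWithoutNonsingularity) : AlgebraicModuliRealPeriodCell :=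
  fun c hc hc0 => h c (AddSubgroup.closure_mono gens_subset_gensNoDisc hc) hc0

/-- **No `_false_without_<H>` theorem exists for any side condition `H` unless the summit is false.** [folklore] -/
theorem not_summit_of_not_cellWithoutSideConditions (h : ¬ CellWithoutSideConditions) :
    ¬ KontsevichZagierPeriods :=
  fun hS => h (cellWithoutSideConditions_of_summit hS)

theorem not_summit_of_not_cellWithoutAlgebraicity (h : ¬ CellWithoutAlgebraicity) : ¬ KontsevichZagierPeriods :=
  fun hS => h (cellWithoutAlgebraicity_of_cellWithoutSideConditions (cellWithoutSideConditions_of_summit hS))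

theorem not_summit_of_not_cellWithoutNonsingularity (h : ¬ CellWithoutNonsingularity) :
    ¬ KontsevichZagierPeriods :=
  fun hS => h (cellWithoutNonsingularity_of_cellWithoutSideConditions (cellWithoutSideConditions_of_summit hS))

/-! ### §2a The algebraicity hypotheses are DECORATION (implied by the existence of `r` when `a ≠ 0`) -/

/-- Large arguments make a depressed cubic positive: `t ≥ |α| + |β| + 1 ⇒ t³ + αt + β > 0`. [folklore] -/
theorem cubic_pos_of_le {α β t : ℝ} (ht : |α| + |β| + 1 ≤ t) : 0 < t ^ 3 + α * t + β := by
  have hαn := abs_nonneg α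
  have hβn := abs_nonneg β
  have h1 : (1 : ℝ) ≤ t := by linarith
  have h0 : (0 : ℝ) ≤ t := by linarith
  have hαt : -(|α| * t) ≤ α * t := by nlinarith [neg_abs_le α]
  have hβ' : -|β| ≤ β := neg_abs_le β
  have ht2 : t ≤ t ^ 2 := by nlinarith
  have ht3 : t * (|α| + |β| + 1) ≤ t ^ 3 := by nlinarith
  have hβt : |β| ≤ |β| * t := by nlinarith
  nlinarith

/-- **The three `IsAlgebraic` hypotheses are implied by the existence of the representation** (for `a ≠ 0`):
if a `KZ.IntegralRep 1` has domain `{P > 0}` and integrand `a/√P` on it, `P = x³ + αx + β`, then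
`a, α, β` are algebraic over `ℚ`. Proof: the integrand is a `ℚ`-semialgebraic function, so its values at
the integer points `N, N+1, N+2, N+3 ∈ {P > 0}` (`N ≥ |α|+|β|+1`) are algebraic
(`IsSemialgebraicFunOn.isAlgebraic_apply`); hence `g(n) = P(n)/a²` is algebraic there, and finite
differences give `6/a² = Δ³g`, `α/a² = Δg(N) − (3N²+3N+1)/a²`, `β/a² = g(N) − N³/a² − Nα/a²`. [folklore] -/
theorem isAlgebraic_of_rep {α β a : ℝ} (r : KZ.IntegralRep 1)
    (hd : r.domain = {x | 0 < x 0 ^ 3 + α * x 0 + β})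
    (hi : EqOn r.integrand (fun x => a / Real.sqrt (x 0 ^ 3 + α * x 0 + β)) r.domain) (ha : a ≠ 0) :
    IsAlgebraic ℚ a ∧ IsAlgebraic ℚ α ∧ IsAlgebraic ℚ β := by
  set K : IntermediateField ℚ ℝ := algebraicClosure ℚ ℝ with hK
  -- `g n = P(n)/a²` is algebraic for `n ≥ |α| + |β| + 1`
  have hg : ∀ n : ℕ, |α| + |β| + 1 ≤ (n : ℝ) → ((n : ℝ) ^ 3 + α * n + β) / a ^ 2 ∈ K := by
    intro n hn
    have hpos : 0 < (n : ℝ) ^ 3 + α * n + β := cubic_pos_of_le hn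
    have hmem : (fun _ : Fin 1 => (n : ℝ)) ∈ r.domain := by
      rw [hd]
      simpa using hpos
    have halg : IsAlgebraic ℚ (r.integrand fun _ => (n : ℝ)) :=
      r.isSemialgebraicFunOn_integrand.isAlgebraic_apply hmem fun _ => isAlgebraic_nat n
    rw [hi hmem] at halg
    have h2 : IsAlgebraic ℚ ((a / Real.sqrt ((n : ℝ) ^ 3 + α * n + β)) *
        (a / Real.sqrt ((n : ℝ) ^ 3 + α * n + β))) := halg.mul halg
    have hsq : (a / Real.sqrt ((n : ℝ) ^ 3 + α * n + β)) * (a / Real.sqrt ((n : ℝ) ^ 3 + α * n + β)) =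
        a ^ 2 / ((n : ℝ) ^ 3 + α * n + β) := by
      rw [div_mul_div_comm, Real.mul_self_sqrt hpos.le, sq]
    rw [hsq] at h2
    have h3 := h2.inv
    rw [inv_div] at h3
    exact mem_algebraicClosure_iff.2 h3
  obtain ⟨N, hN⟩ := exists_nat_ge (|α| + |β| + 1)
  have g0 := hg N hN
  have g1 := hg (N + 1) (by push_cast; linarith)
  have g2 := hg (N + 2) (by push_cast; linarith)
  have g3 := hg (N + 3) (by push_cast; linarith)
  push_cast at g1 g2 g3
  have h3K : (3 : ℝ) ∈ K := by simp
  have h6K : (6 : ℝ) ∈ K := by simp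
  have hNK : (N : ℝ) ∈ K := natCast_mem K N
  -- u = 1/a²
  have hu_eq : (a ^ 2)⁻¹ = ((((N : ℝ) + 3) ^ 3 + α * ((N : ℝ) + 3) + β) / a ^ 2 -
      3 * ((((N : ℝ) + 2) ^ 3 + α * ((N : ℝ) + 2) + β) / a ^ 2) +
      3 * ((((N : ℝ) + 1) ^ 3 + α * ((N : ℝ) + 1) + β) / a ^ 2) -
      ((N : ℝ) ^ 3 + α * N + β) / a ^ 2) / 6 := by
    field_simp
    ring
  have hu : (a ^ 2)⁻¹ ∈ K := by
    rw [hu_eq]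
    exact div_mem (sub_mem (add_mem (sub_mem g3 (mul_mem h3K g2)) (mul_mem h3K g1)) g0) h6K
  -- v = α/a²
  have hv_eq : α / a ^ 2 = (((N : ℝ) + 1) ^ 3 + α * ((N : ℝ) + 1) + β) / a ^ 2 -
      ((N : ℝ) ^ 3 + α * N + β) / a ^ 2 - (3 * (N : ℝ) ^ 2 + 3 * N + 1) * (a ^ 2)⁻¹ := by
    field_simp
    ring
  have hcoef : (3 * (N : ℝ) ^ 2 + 3 * N + 1) ∈ K :=
    add_mem (add_mem (mul_mem h3K (pow_mem hNK 2)) (mul_mem h3K hNK)) (one_mem K)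
  have hv : α / a ^ 2 ∈ K := by
    rw [hv_eq]
    exact sub_mem (sub_mem g1 g0) (mul_mem hcoef hu)
  -- w = β/a²
  have hw_eq : β / a ^ 2 = ((N : ℝ) ^ 3 + α * N + β) / a ^ 2 - (N : ℝ) ^ 3 * (a ^ 2)⁻¹ -
      (N : ℝ) * (α / a ^ 2) := by
    field_simp
    ring
  have hw : β / a ^ 2 ∈ K := by
    rw [hw_eq]
    exact sub_mem (sub_mem g0 (mul_mem (pow_mem hNK 3) hu)) (mul_mem hNK hv)
  -- back to `a, α, β`
  have ha2 : a ^ 2 ∈ K := by simpa using inv_mem hu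
  have hαK : α ∈ K := by
    have : α = α / a ^ 2 * a ^ 2 := by field_simp
    rw [this]
    exact mul_mem hv ha2
  have hβK : β ∈ K := by
    have : β = β / a ^ 2 * a ^ 2 := by field_simp
    rw [this]
    exact mul_mem hw ha2
  refine ⟨?_, mem_algebraicClosure_iff.1 hαK, mem_algebraicClosure_iff.1 hβK⟩
  exact IsAlgebraic.of_pow two_pos (mem_algebraicClosure_iff.1 ha2)

/-- Zero-integrand generators are relations (tree: `KZ.of_mem_relations_of_eqOn_zero`). [folklore] -/
theorem of_mem_relations_of_scalar_zero {α β a : ℝ} (r : KZ.IntegralRep 1)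
    (hi : EqOn r.integrand (fun x => a / Real.sqrt (x 0 ^ 3 + α * x 0 + β)) r.domain) (ha : a = 0) :
    KZ.of r ∈ KZ.relations := by
  refine KZ.of_mem_relations_of_eqOn_zero r fun x hx => ?_
  rw [hi hx, ha]
  simp

/-- The generators without algebraicity hypotheses are generators of the cell or relations. [folklore] -/
theorem gensNoAlg_subset : gensNoAlg ⊆ gens ∪ (KZ.relations : Set KZ.FormalRep) := by
  rintro d ⟨α, β, a, r, hΔ, hd, hi, rfl⟩
  by_cases ha : a = 0
  · exact Or.inr (of_mem_relations_of_scalar_zero r hi ha)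
  · obtain ⟨h1, h2, h3⟩ := isAlgebraic_of_rep r hd hi ha
    exact Or.inl ⟨α, β, a, r, h2, h3, h1, hΔ, hd, hi, rfl⟩

/-- **The three algebraicity hypotheses are decoration**: the crux is EQUIVALENT to the same statement
with `IsAlgebraic ℚ α ∧ IsAlgebraic ℚ β ∧ IsAlgebraic ℚ a` deleted (they can be neither load-bearing nor a
source of vacuity). [folklore] -/
theorem cell_iff_cellWithoutAlgebraicity : AlgebraicModuliRealPeriodCell ↔ CellWithoutAlgebraicity := by
  refine ⟨fun h c hc hc0 => ?_, cell_of_cellWithoutAlgebraicity⟩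
  have hc' : c ∈ AddSubgroup.closure gens ⊔ KZ.relations := by
    have hle : AddSubgroup.closure gensNoAlg ≤ AddSubgroup.closure gens ⊔ KZ.relations := by
      rw [AddSubgroup.closure_le]
      intro d hd
      rcases gensNoAlg_subset hd with hd | hd
      · exact AddSubgroup.mem_sup_left (AddSubgroup.subset_closure hd)
      · exact AddSubgroup.mem_sup_right hd
    exact hle hc
  obtain ⟨c₁, hc₁, c₂, hc₂, rfl⟩ := AddSubgroup.mem_sup.1 hc'
  have h₂ : KZ.eval c₂ = 0 := AddMonoidHom.mem_ker.1 (KZ.relations_le_ker_eval_holds hc₂)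
  have h₁ : KZ.eval c₁ = 0 := by
    rw [map_add, h₂, add_zero] at hc0
    exact hc0
  exact add_mem (h c₁ hc₁ h₁) hc₂

/-! ### §2b The nonsingularity hypothesis: not load-bearing for truth, and dropping it adds no junk

`CellWithoutNonsingularity` is still inside the summit (above). What it ADDS to the sector: for
`P = (x−t)²(x+2t)` with `t < 0` algebraic the generators exist (domain `(2|t|, ∞)`, integrand
`a/((x+|t|)√(x−2|t|))`, value `a·π/√(3|t|)` — an elementary `ℚ̄·π` sector whose internal relations are
explicit change-of-variables chains, and which has no relation with the elliptic periods since `Ω/π ∉ ℚ̄`);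
at the cusp `t = 0` and for `t > 0` (double root inside the closure of `{P > 0}`) NO representation exists,
the integrand failing to be integrable at the double root. The cusp case, formally: -/

/-- The coordinate image of `(0, ∞)` under `ℝ¹ ≃ ℝ`. [folklore] -/
theorem funUnique_preimage_Ioi :
    (⇑(MeasurableEquiv.funUnique (Fin 1) ℝ)) ⁻¹' Ioi 0 = {x : Fin 1 → ℝ | 0 < x 0} := by
  ext x
  simp [MeasurableEquiv.funUnique]

/-- **No representation at the cusp.** With `α = β = 0` (algebraic!) and `a ≠ 0` there is NO
`KZ.IntegralRep 1` with domain `{x³ > 0}` and integrand `a/√(x³)` on it: `a·x^{-3/2}` is not integrable at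
`0⁺` (`intervalIntegral.integrableOn_Ioo_rpow_iff`). So deleting `4α³+27β² ≠ 0` makes this instance
vacuous, not false. [folklore] -/
theorem no_rep_at_cusp {a : ℝ} (ha : a ≠ 0) (r : KZ.IntegralRep 1)
    (hd : r.domain = {x | 0 < x 0 ^ 3 + 0 * x 0 + 0})
    (hi : EqOn r.integrand (fun x => a / Real.sqrt (x 0 ^ 3 + 0 * x 0 + 0)) r.domain) : False := by
  have hd' : r.domain = {x : Fin 1 → ℝ | 0 < x 0} := by
    rw [hd]
    ext x
    simp only [zero_mul, add_zero, mem_setOf_eq]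
    exact Odd.pow_pos_iff (by decide : Odd 3)
  have hint : IntegrableOn (fun x : Fin 1 → ℝ => a / Real.sqrt (x 0 ^ 3)) {x | 0 < x 0} := by
    rw [← hd']
    refine r.integrableOn.congr_fun (fun x hx => ?_) (KZ.IntegralRep.measurableSet_domain_holds r)
    rw [hi hx]
    simp
  -- transport to `ℝ`
  have e := volume_preserving_funUnique (Fin 1) ℝ
  have h2 : IntegrableOn (fun t : ℝ => a / Real.sqrt (t ^ 3)) (Ioi 0) := by
    refine (e.integrableOn_comp_preimage (MeasurableEquiv.measurableEmbedding _)).1 ?_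
    have hcomp : ((fun t : ℝ => a / Real.sqrt (t ^ 3)) ∘ ⇑(MeasurableEquiv.funUnique (Fin 1) ℝ)) =
        fun x => a / Real.sqrt (x 0 ^ 3) := by
      funext x
      simp [MeasurableEquiv.funUnique]
    rw [funUnique_preimage_Ioi, hcomp]
    exact hint
  -- restrict to `(0,1)` and compare with `t^{-3/2}`
  have h3 : IntegrableOn (fun t : ℝ => t ^ (-(3 / 2) : ℝ)) (Ioo 0 1) := by
    have h4 : IntegrableOn (fun t : ℝ => a⁻¹ * (a / Real.sqrt (t ^ 3))) (Ioo 0 1) :=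
      (h2.mono_set Ioo_subset_Ioi_self).const_mul a⁻¹
    refine h4.congr_fun (fun t ht => ?_) measurableSet_Ioo
    have ht0 : 0 < t := ht.1
    show a⁻¹ * (a / Real.sqrt (t ^ 3)) = t ^ (-(3 / 2) : ℝ)
    rw [← mul_div_assoc, inv_mul_cancel₀ ha, Real.sqrt_eq_rpow, ← Real.rpow_natCast,
      ← Real.rpow_mul ht0.le, one_div, Real.rpow_neg ht0.le]
    norm_num
  have := (intervalIntegral.integrableOn_Ioo_rpow_iff one_pos).1 h3
  norm_num at this

/-! ## §3 The value hypothesis `eval c = 0` is load-bearing (and the generating set is non-empty) -/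

/-- The crux with the hypothesis `KZ.eval c = 0` deleted. [folklore] -/
def CellWithoutValueHypothesis : Prop :=
  ∀ c ∈ AddSubgroup.closure gens, c ∈ KZ.relations

/-- The tree's period representations `[{x³+Ax+B>0}, a/√(x³+Ax+B)]` (`A B : ℤ`, `a : ℚ`) are generators of
the cell. [folklore] -/
theorem of_periodRep_mem_gens (A B : ℤ) (a : ℚ) (h : 4 * A ^ 3 + 27 * B ^ 2 ≠ 0) :
    KZ.of (periodRep A B a h) ∈ gens := by
  refine ⟨(A : ℝ), (B : ℝ), (a : ℝ), periodRep A B a h, isAlgebraic_int A, isAlgebraic_int B, ?_, ?_, rfl,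
    fun x _ => rfl, rfl⟩
  · simpa using isAlgebraic_algebraMap (R := ℚ) (A := ℝ) a
  · exact_mod_cast h

/-- **`eval c = 0` is load-bearing**: without it the statement is false — the generator
`[{x³+1>0}, 1/√(x³+1)]` has value `Ω(E_{0,1}) > 0`, and relations evaluate to `0`. [folklore] -/
theorem cell_false_without_valueHypothesis : ¬ CellWithoutValueHypothesis := by
  intro h
  have h27 : (4 : ℤ) * 0 ^ 3 + 27 * 1 ^ 2 ≠ 0 := by norm_num
  have hmem := h _ (AddSubgroup.subset_closure (of_periodRep_mem_gens 0 1 1 h27))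
  have h0 : KZ.eval (KZ.of (periodRep 0 1 1 h27)) = 0 :=
    AddMonoidHom.mem_ker.1 (KZ.relations_le_ker_eval_holds hmem)
  rw [KZ.eval_of, periodRep_value] at h0
  have hpos := realPeriod_pos h27
  simp only [Rat.cast_one, one_mul] at h0
  exact hpos.ne' h0

/-- Hence the generating set is non-empty and not contained in the relations: the crux is not vacuous.
[folklore] -/
theorem gens_not_subset_relations : ¬ (gens ⊆ (KZ.relations : Set KZ.FormalRep)) := fun h =>
  cell_false_without_valueHypothesis fun _ hc => (AddSubgroup.closure_le (K := KZ.relations)).2 h hc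

/-! ## §4 Values of the generators; the one-cubic part of the cell is TRUE -/

/-- The real short Weierstrass model `y² = x³ + αx + β`. [folklore] -/
def curveR (α β : ℝ) : WeierstrassCurve ℝ := ⟨0, 0, 0, α, β⟩

/-- Its 2-torsion polynomial is `4(x³ + αx + β)`. [folklore] -/
theorem curveR_ψ (α β t : ℝ) :
    (curveR α β).twoTorsionPolynomial.toPoly.eval t = 4 * (t ^ 3 + α * t + β) := by
  simp only [curveR, WeierstrassCurve.twoTorsionPolynomial, Cubic.toPoly, WeierstrassCurve.b₂,
    WeierstrassCurve.b₄, WeierstrassCurve.b₆, eval_add, eval_mul, eval_C, eval_pow, eval_X]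
  ring

/-- Its discriminant is `−16(4α³ + 27β²)`. [folklore] -/
theorem curveR_Δ (α β : ℝ) : (curveR α β).Δ = -16 * (4 * α ^ 3 + 27 * β ^ 2) := by
  simp only [curveR, WeierstrassCurve.Δ, WeierstrassCurve.b₂, WeierstrassCurve.b₄,
    WeierstrassCurve.b₆, WeierstrassCurve.b₈]
  ring

/-- `4α³ + 27β² ≠ 0` makes it an elliptic curve. [folklore] -/
theorem curveR_isElliptic {α β : ℝ} (h : 4 * α ^ 3 + 27 * β ^ 2 ≠ 0) : (curveR α β).IsElliptic := by
  rw [WeierstrassCurve.isElliptic_iff, curveR_Δ, isUnit_iff_ne_zero]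
  exact mul_ne_zero (by norm_num) h

/-- The 2-torsion set is `{x³ + αx + β > 0}`. [folklore] -/
theorem curveR_twoTorsionSet (α β : ℝ) : (curveR α β).twoTorsionSet = {t | 0 < t ^ 3 + α * t + β} := by
  ext t
  rw [WeierstrassCurve.mem_twoTorsionSet_iff, curveR_ψ, mem_setOf_eq]
  exact mul_pos_iff_of_pos_left (by norm_num)

/-- `a/√P = 2a·(√ψ)⁻¹`, `ψ = 4P` (also at the junk value `√P = 0`). [folklore] -/
theorem div_sqrt_eq (a t α β : ℝ) :
    a / Real.sqrt (t ^ 3 + α * t + β) = 2 * a * (Real.sqrt ((curveR α β).twoTorsionPolynomial.toPoly.eval t))⁻¹ := by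
  rw [curveR_ψ, sqrt_four_mul]
  by_cases hu : Real.sqrt (t ^ 3 + α * t + β) = 0
  · simp [hu]
  · field_simp

/-- `∫_{x ∈ ℝ¹, P(x₀)>0} a/√P(x₀) = a · Ω(E_{α,β})` (transport `ℝ¹ → ℝ`, `realPeriod = 2∫_{ψ>0} (√ψ)⁻¹`).
[cite: CremonaAlgorithms1997, §3.7] -/
theorem setIntegral_rep (α β a : ℝ) :
    ∫ x in {x : Fin 1 → ℝ | 0 < x 0 ^ 3 + α * x 0 + β}, a / Real.sqrt (x 0 ^ 3 + α * x 0 + β) =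
      a * (curveR α β).realPeriod := by
  have he := MeasureTheory.volume_preserving_funUnique (Fin 1) ℝ
  have h1 := he.setIntegral_preimage_emb (MeasurableEquiv.measurableEmbedding _)
    (fun t : ℝ => a / Real.sqrt (t ^ 3 + α * t + β)) {t | 0 < t ^ 3 + α * t + β}
  refine h1.trans ?_
  have hmeas : MeasurableSet {t : ℝ | 0 < t ^ 3 + α * t + β} := by
    rw [← curveR_twoTorsionSet]; exact (curveR α β).measurableSet_twoTorsionSet
  rw [setIntegral_congr_fun hmeas (fun t _ => div_sqrt_eq a t α β), integral_const_mul,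
    WeierstrassCurve.realPeriod, curveR_twoTorsionSet]
  ring

/-- **Value of a generator**: any representation with the cell's domain and integrand-on-domain has value
`a · Ω(E_{α,β})`, `Ω = WeierstrassCurve.realPeriod ⟨0,0,0,α,β⟩ = ∫_{P>0} dx/√P`. [cite: CremonaAlgorithms1997, §3.7] -/
theorem value_eq {α β a : ℝ} {r : KZ.IntegralRep 1} (hd : r.domain = {x | 0 < x 0 ^ 3 + α * x 0 + β})
    (hi : EqOn r.integrand (fun x => a / Real.sqrt (x 0 ^ 3 + α * x 0 + β)) r.domain) :
    r.value = a * (curveR α β).realPeriod := by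
  unfold KZ.IntegralRep.value
  rw [setIntegral_congr_fun (KZ.IntegralRep.measurableSet_domain_holds r) hi, hd]
  exact setIntegral_rep α β a

/-- `Ω(E_{α,β}) > 0` for nonsingular real `(α, β)` (tree: `realPeriod_pos'`). [folklore] -/
theorem realPeriodR_pos {α β : ℝ} (h : 4 * α ^ 3 + 27 * β ^ 2 ≠ 0) : 0 < (curveR α β).realPeriod := by
  haveI := curveR_isElliptic h
  exact (curveR α β).realPeriod_pos'

/-- **A single generator with value `0` is a relation** (its scalar is `0`, its integrand vanishes on the
domain): the crux holds on `gens` itself, so any counterexample combines ≥ 2 generators. [folklore] -/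
theorem single_generator_kernel {α β a : ℝ} (hΔ : 4 * α ^ 3 + 27 * β ^ 2 ≠ 0) (r : KZ.IntegralRep 1)
    (hd : r.domain = {x | 0 < x 0 ^ 3 + α * x 0 + β})
    (hi : EqOn r.integrand (fun x => a / Real.sqrt (x 0 ^ 3 + α * x 0 + β)) r.domain)
    (h0 : KZ.eval (KZ.of r) = 0) : KZ.of r ∈ KZ.relations := by
  rw [KZ.eval_of, value_eq hd hi] at h0
  have ha : a = 0 := (mul_eq_zero.1 h0).resolve_right (realPeriodR_pos hΔ).ne'
  exact of_mem_relations_of_scalar_zero r hi ha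

/-- **Two generators on the SAME cubic with value `0` form a relation** (`aΩ = bΩ ⇒ a = b ⇒` the
integrands agree on the common domain; tree: `KZ.of_sub_of_mem_relations_of_eqOn`). So a counterexample
involves two DISTINCT cubics, i.e. a genuine `ℚ̄`-linear relation between real periods of different
curves. [folklore] -/
theorem same_cubic_kernel₂ {α β a b : ℝ} (hΔ : 4 * α ^ 3 + 27 * β ^ 2 ≠ 0) (r r' : KZ.IntegralRep 1)
    (hd : r.domain = {x | 0 < x 0 ^ 3 + α * x 0 + β})
    (hi : EqOn r.integrand (fun x => a / Real.sqrt (x 0 ^ 3 + α * x 0 + β)) r.domain)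
    (hd' : r'.domain = {x | 0 < x 0 ^ 3 + α * x 0 + β})
    (hi' : EqOn r'.integrand (fun x => b / Real.sqrt (x 0 ^ 3 + α * x 0 + β)) r'.domain)
    (h0 : KZ.eval (KZ.of r - KZ.of r') = 0) : KZ.of r - KZ.of r' ∈ KZ.relations := by
  rw [map_sub, KZ.eval_of, KZ.eval_of, value_eq hd hi, value_eq hd' hi', sub_eq_zero] at h0
  have hab : a = b := mul_right_cancel₀ (realPeriodR_pos hΔ).ne' h0
  refine KZ.of_sub_of_mem_relations_of_eqOn (hd'.trans hd.symm) fun x hx => ?_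
  have hx' : x ∈ r'.domain := by rw [hd', ← hd]; exact hx
  rw [hi hx, hi' hx', hab]

/-! ## §5 Method level: the `(−1)`-twist is really-isogenous to the curve only under CM -/

/-- **A real lattice admits a real isogeny onto its `(−1)`-twist `iΛ` only if it has CM**: a real
`ν ≠ 0` with `ν·i·Λ ⊆ Λ` is a non-integral multiplier. (Converse: the ideator's `cm_imaginary_multiplier`.)
Consequence for `stub_algNormalForm`: for a NON-CM real cubic `E : y² = x³+αx+β` the twist
`E^tw : y² = x³+αx−β` (lattice `iΛ`, `g₂ ↦ g₂`, `g₃ ↦ −g₃`) is `ℂ`-isomorphic but NOT really-isogenous to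
`E`, and `Ω(E) = ω₁`, `Ω(E^tw) = ω₂/i` (up to `ℚˣ`) are `ℚ̄`-independent by the non-CM block of
`HuberWustholzManyCurvePeriods_holds`; a normal form over "pairwise non-ℂ-isogenous curves" therefore does
not exist for `[E] − [E^tw]`, the right notion is "pairwise not joined by a real datum". [folklore] -/
theorem no_real_mul_I_of_not_hasCM (L : PeriodPair) (h : ¬ L.HasCM) {ν : ℝ} (hν : ν ≠ 0)
    (hmul : ∀ l ∈ L.lattice, (ν : ℂ) * Complex.I * l ∈ L.lattice) : False := by
  refine h ⟨(ν : ℂ) * Complex.I, fun n hn => ?_, hmul⟩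
  have := congrArg Complex.im hn
  simp at this
  exact hν this

/-- Conversely (recorded from the ideator's sketch, reproved here to keep this file self-contained): a CM
real lattice HAS a purely imaginary multiplier `iν`, `ν ≠ 0` real — the real isogeny `E → E^tw`
(`√−3` on `y² = x³+1`: the calibration `Ω(x³+1) = √3·Ω(x³−1)`). Needs `Λ̄ = Λ`. [folklore] -/
theorem exists_real_mul_I_of_hasCM (L : PeriodPair) (hreal : ∀ l ∈ L.lattice, (starRingEnd ℂ) l ∈ L.lattice)
    (h : L.HasCM) : ∃ ν : ℝ, ν ≠ 0 ∧ ∀ l ∈ L.lattice, (ν : ℂ) * Complex.I * l ∈ L.lattice := by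
  obtain ⟨α, hαn, hα⟩ := h
  -- conjugate multiplier
  have hc : ∀ l ∈ L.lattice, (starRingEnd ℂ) α * l ∈ L.lattice := by
    intro l hl
    have h1 : α * (starRingEnd ℂ) l ∈ L.lattice := hα _ (hreal l hl)
    have h2 := hreal _ h1
    simpa [map_mul] using h2
  have him : α.im ≠ 0 := by
    intro him
    -- a real multiplier of a lattice into itself is an integer
    obtain ⟨a, b, hab⟩ := PeriodPair.mem_lattice.1 (hα _ L.ω₁_mem_lattice)
    have hre : α = (α.re : ℂ) := Complex.ext (by simp) (by simp [him])
    have h0 : ((α.re - a : ℝ) : ℂ) * L.ω₁ + ((-b : ℝ) : ℂ) * L.ω₂ = 0 := by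
      push_cast
      have := hab
      rw [hre] at this
      linear_combination -this
    have hind := LinearIndependent.pair_iff.mp L.indep (α.re - a) (-b) (by
      simpa [smul_eq_mul] using h0)
    have : α.re = a := by linarith [hind.1]
    exact hαn a (by rw [hre, this]; simp)
  refine ⟨2 * α.im, by positivity, fun l hl => ?_⟩
  have hsub : (α - (starRingEnd ℂ) α) * l ∈ L.lattice := by
    rw [sub_mul]
    exact sub_mem (hα l hl) (hc l hl)
  have key : ((2 * α.im : ℝ) : ℂ) * Complex.I = α - (starRingEnd ℂ) α := by
    rw [Complex.sub_conj]
  rw [key]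
  exact hsub

/-- **The transcendence half of the twist dichotomy** (instance `k = 1` of the tree THEOREM
`HuberWustholzManyCurvePeriods_holds`): for a NON-CM lattice with algebraic invariants, `ω₁` and `ω₂` are
`ℚ̄`-linearly independent. For a real rectangular lattice `ω₁ = Ω(E)`-ish is the real period of `E` and
`ω₂/i` that of the twist `E^tw` (lattice `iΛ`), so `[E] − q·[E^tw]` is never a value-`0` combination for
`E` non-CM, while for CM it is (e.g. `q = √3` at `j = 0`) and is certified by the real isogeny of
`exists_real_mul_I_of_hasCM`. [cite: HuberWustholz2022, Thm. 15.3 (1)] -/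
theorem nonCM_omega_independent (L : PeriodPair) (h₂ : IsAlgebraic ℚ L.g₂) (h₃ : IsAlgebraic ℚ L.g₃)
    (hCM : ¬ L.HasCM) {a b : ℂ} (ha : IsAlgebraic ℚ a) (hb : IsAlgebraic ℚ b)
    (h : a * L.ω₁ + b * L.ω₂ = 0) : a = 0 ∧ b = 0 := by
  have key := HuberWustholzManyCurvePeriods_holds.omega_relation (k := 1) (L := ![L]) (a := ![a]) (b := ![b])
    (c := 0) (fun i => by fin_cases i; exact ⟨h₂, h₃⟩)
    (fun i j hij => absurd (Subsingleton.elim i j) hij)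
    (fun i => by fin_cases i; exact ⟨ha, hb⟩) isAlgebraic_zero
    (fun i hi => by fin_cases i; exact absurd hi hCM)
    (by simp [h])
  simpa using key.2 0

end Summit.KontsevichZagierPeriods.KontsevichZagierPeriods.Cruxes.AlgebraicModuliRealPeriodCell.Disproof
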